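import Summits.ValiantsHypothesis.ValiantsHypothesis.Theorems.GrenetZeonDualUnipotentThreeHalvesHeavyTopRatioSpeed
import Summits.ValiantsHypothesis.ValiantsHypothesis.Theorems.GrenetZeonDualUnipotentThreeHalvesHeavyTopHalfSpeedSeam
import Summits.ValiantsHypothesis.ValiantsHypothesis.Theorems.GrenetZeonDualUnipotentThreeHalvesHeavyTopFourSixTriangularisable

/-!
# The TRIANGULARISABLE RUNG of `DenseRatioLaw` (val-idea-30 g2, `HALFSPEED-DEAD.md` §4; crux `GrenetZeon.DualUnipotentThreeHalves` =
# stmt-ValiantsHypothesis-24318, residue R2 `HeavyTopLaw`): the residual uniform law HOLDS with `C = 32`, `ρ = 1`, for every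
# simultaneously triangularisable space

Over val-port-2 g2's VERBATIM vocabulary port ✓ p668637 `…HeavyTopRatioSpeed.lean` (`RatioSpeed`, `Shifts`, `ratioSpeed_of_shifts`,
`DenseRatioLaw`).  Port hand val-port-1 g3 (director-valiant g16 RULING R296 (2) «ONE bankable port: idea-30's triangularisable rung of `DenseRatioLaw` (C = 32;
crit-7 #15 arithmetic ✓)», desk RULING #343 (2); `--supports stmt-ValiantsHypothesis-24318 --as helper`).  RECIPE (idea-30 g2, paper;
val-port-2 g2's sizing 20:59:35Z): conjugate `U` into the strictly upper triangular matrices `𝔫_d`; equipartition `Fin d` into `L = Θ + 1`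
consecutive blocks (`Θ = ⌊√D⌋/4`, `D = dim U`, block size `s = ⌊(d−1)/L⌋ + 1`, levels `lvl i = (d−1−i)/s ∈ [0, Θ]` DEcreasing in `i`);
`T := U ∩ 𝔟_L` = the elements of `U` vanishing at the within-block strictly-upper positions.  Then `𝔫_d` never drops a level and `𝔟_L`
climbs one, so ✓ `ratioSpeed_of_shifts` gives `RatioSpeed 1 Θ U T`; `codim_U T ≤ #{within-block strictly-upper positions} ≤ d(s−1)/2`
(rank–nullity for the coordinate projection + ✓ `RadicalSplit.card_sameBlock_pairs_le`, val-port-2 g2's exact pair count), and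
`8·codim ≤ 4d(s−1) ≤ 4d(d−1)/L·L ≤ …`, precisely `L·(8·codim) ≤ 4d² ≤ 8d² ≤ D·L` once `32·d² ≤ D·⌊√D⌋` (`4L ≥ ⌊√D⌋ + 1`).

* `ratioSpeed_of_conj` — ratio-speed pulls back along a conjugation `X ↦ C X D` (`C D = D C = 1`; on ✓ `HalfSpeed.gword_conj`);
* `level_lt` — the block arithmetic `(d−1−i)/s < L`;
* ★ `denseRatio_of_strictUpper` — the rung for `U ⊆ 𝔫_d` literally: `∃ T ≤ U, 8·(dim U − dim T) ≤ dim U ∧ RatioSpeed 1 (⌊√(dim U)⌋/4) U T`;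
* ★★ `denseRatio_of_triangularisable` — the rung for every `U` conjugate into `𝔫_d` (`C U D ⊆ 𝔫_d`, `C D = D C = 1`), in the exact
  shape of `DenseRatioLaw`'s conclusion (`∃ ρ T, 1 ≤ ρ ∧ T ≤ U ∧ 4(ρ+1)(dim U − dim T) ≤ dim U ∧ RatioSpeed ρ (⌊√(dim U)⌋/4) U T`, with
  `ρ = 1`) under the density hypothesis with `C = 32` — transported back by ✓ `ratioSpeed_of_conj` and `LinearEquiv.finrank_map_eq`.
  (The law's nilpotency hypothesis is implied by triangularisability and not used.)

HONEST FRAMING: a calibration rung — `DenseRatioLaw`'s content sits entirely in the dense NON-triangularisable regime (MOR-type tops), the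
same place as R2's; `DenseRatioLaw` / R2 `HeavyTopLaw` / 24318 / 8062 OPEN; `VP ≠ VNP` NOT proved; nothing here is a summit statement.
-/

noncomputable section

-- single-conjunct layout: Sub = Summit, duplicated namespace component intended
set_option linter.dupNamespace false
set_option autoImplicit false

namespace Summit.ValiantsHypothesis.ValiantsHypothesis.Theorems.GrenetZeon.RatioSpeed

open Matrix
open scoped BigOperators
open Summit.ValiantsHypothesis.ValiantsHypothesis.Theorems.GrenetZeon.RadicalSplit (card_sameBlock_pairs_le)

/-- **Transport under conjugation** (from ✓ `HalfSpeed.gword_conj`): if the conjugated spaces `C U D`, `C T D` have ratio-speed `(ρ, Θ)`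
then so have `U`, `T` — words conjugate termwise and conjugation by an invertible pair kills no word. -/
theorem ratioSpeed_of_conj {ι : Type*} [Fintype ι] [DecidableEq ι] (C D : Matrix ι ι ℂ) (hCD : C * D = 1) (hDC : D * C = 1)
    (ρ Θ : ℕ) (U T : Set (Matrix ι ι ℂ))
    (h : RatioSpeed ρ Θ ((fun X => C * X * D) '' U) ((fun X => C * X * D) '' T)) :
    RatioSpeed ρ Θ U T := by
  intro P hP Q hQ w hw
  refine h _ ⟨P, hP, rfl⟩ _ ⟨Q, hQ, rfl⟩ w ?_
  intro h0
  apply hw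
  have h0' : HalfSpeed.gword (C * P * D) (C * Q * D) w = 0 := h0
  rw [HalfSpeed.gword_conj C D hCD hDC] at h0'
  have := congrArg (fun X => D * X * C) h0'
  simp only [Matrix.mul_zero, Matrix.zero_mul] at this
  calc HalfSpeed.gword P Q w = (D * C) * HalfSpeed.gword P Q w * (D * C) := by rw [hDC, Matrix.one_mul, Matrix.mul_one]
    _ = D * (C * HalfSpeed.gword P Q w * D) * C := by simp only [Matrix.mul_assoc]
    _ = 0 := this

/-- block arithmetic: with block size `s = (d−1)/L + 1` (`L ≥ 1`) every level `(d−1−i)/s`, `i < d`, is `< L`. -/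
theorem level_lt (d L : ℕ) (hL : 1 ≤ L) (i : Fin d) : (d - 1 - (i : ℕ)) / ((d - 1) / L + 1) < L := by
  have hs : 0 < (d - 1) / L + 1 := Nat.succ_pos _
  rw [Nat.div_lt_iff_lt_mul hs]
  have h1 : d - 1 - (i : ℕ) ≤ d - 1 := Nat.sub_le _ _
  have h2 := Nat.div_add_mod (d - 1) L
  have h3 := Nat.mod_lt (d - 1) (show 0 < L by omega)
  have h4 : L * ((d - 1) / L + 1) = L * ((d - 1) / L) + L := by ring
  rw [h4]
  generalize L * ((d - 1) / L) = q at h2 ⊢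
  omega

/-- ★ **THE RUNG FOR `U ⊆ 𝔫_d`** (strictly upper triangular): under `32·d² ≤ D·⌊√D⌋` (`D = dim U`) there is `T ≤ U` of codimension
`≤ D/8` with `RatioSpeed 1 (⌊√D⌋/4) U T` — `T` = the elements of `U` vanishing at the strictly-upper positions inside the `⌊√D⌋/4 + 1`
equipartition blocks. -/
theorem denseRatio_of_strictUpper (d : ℕ) (U : Submodule ℂ (Matrix (Fin d) (Fin d) ℂ))
    (htri : ∀ A ∈ U, ∀ i j : Fin d, j ≤ i → A i j = 0)
    (hdense : 32 * d ^ 2 ≤ Module.finrank ℂ U * Nat.sqrt (Module.finrank ℂ U)) :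
    ∃ T : Submodule ℂ (Matrix (Fin d) (Fin d) ℂ), T ≤ U ∧
      8 * (Module.finrank ℂ U - Module.finrank ℂ T) ≤ Module.finrank ℂ U ∧
      RatioSpeed 1 (Nat.sqrt (Module.finrank ℂ U) / 4)
        (U : Set (Matrix (Fin d) (Fin d) ℂ)) (T : Set (Matrix (Fin d) (Fin d) ℂ)) := by
  classical
  -- parameters: height `Θ`, number of blocks `L`, block size `s`, levels
  set D := Module.finrank ℂ U with hD
  set Θ := Nat.sqrt D / 4 with hΘ
  set L := Θ + 1 with hL
  have hL1 : 1 ≤ L := by rw [hL]; exact Nat.le_add_left 1 _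
  set s := (d - 1) / L + 1 with hs
  have hs1 : 1 ≤ s := by rw [hs]; exact Nat.le_add_left 1 _
  set lvl : Fin d → ℕ := fun i => (d - 1 - (i : ℕ)) / s with hlvl
  have hlvl_le : ∀ i, lvl i ≤ Θ := fun i => by
    have h := level_lt d L hL1 i
    rw [← hs] at h
    show (d - 1 - (i : ℕ)) / s ≤ Θ
    omega
  have hlvl_anti : ∀ i j : Fin d, i ≤ j → lvl j ≤ lvl i := fun i j hij =>
    Nat.div_le_div_right (by have : (i : ℕ) ≤ j := hij; omega)
  -- the within-block strictly-upper positions and the coordinate projection onto them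
  set π : Matrix (Fin d) (Fin d) ℂ →ₗ[ℂ] ({q : Fin d × Fin d // q.1 < q.2 ∧ lvl q.1 = lvl q.2} → ℂ) :=
    { toFun := fun A q => A q.1.1 q.1.2, map_add' := fun A B => rfl, map_smul' := fun c A => rfl } with hπ
  set f := π.comp U.subtype with hf
  set T := (LinearMap.ker f).map U.subtype with hT
  have hTU : T ≤ U := Submodule.map_subtype_le U _
  have hTmem : ∀ Q ∈ T, Q ∈ U ∧ ∀ q : {q : Fin d × Fin d // q.1 < q.2 ∧ lvl q.1 = lvl q.2}, Q q.1.1 q.1.2 = 0 := by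
    intro Q hQ
    obtain ⟨x, hx, rfl⟩ := Submodule.mem_map.1 hQ
    refine ⟨x.2, fun q => ?_⟩
    have h0 : f x = 0 := LinearMap.mem_ker.1 hx
    exact congrFun h0 q
  -- codimension ≤ number of positions ≤ d(s-1)/2
  have hcodim : D - Module.finrank ℂ T ≤ Fintype.card {q : Fin d × Fin d // q.1 < q.2 ∧ lvl q.1 = lvl q.2} := by
    have h1 : Module.finrank ℂ T = Module.finrank ℂ (LinearMap.ker f) := Submodule.finrank_map_subtype_eq U _
    have h2 := LinearMap.finrank_range_add_finrank_ker f
    have h3 : Module.finrank ℂ (LinearMap.range f) ≤ Fintype.card {q : Fin d × Fin d // q.1 < q.2 ∧ lvl q.1 = lvl q.2} :=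
      calc Module.finrank ℂ (LinearMap.range f)
          ≤ Module.finrank ℂ ({q : Fin d × Fin d // q.1 < q.2 ∧ lvl q.1 = lvl q.2} → ℂ) := Submodule.finrank_le _
        _ = Fintype.card {q : Fin d × Fin d // q.1 < q.2 ∧ lvl q.1 = lvl q.2} := Module.finrank_fintype_fun_eq_card ℂ
    omega
  have hpairs := card_sameBlock_pairs_le d s hs1 lvl (fun i => rfl)
  -- the budget arithmetic: `L · (8 · codim) ≤ 4 d² ≤ 8 d² ≤ D · L`
  have hbudget : 8 * (D - Module.finrank ℂ T) ≤ D := by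
    have e1 : L * (s - 1) ≤ d - 1 := by
      have : s - 1 = (d - 1) / L := by omega
      rw [this]; exact Nat.mul_div_le (d - 1) L
    have e2 : 8 * (D - Module.finrank ℂ T) ≤ 4 * (d * (s - 1)) := by
      have := hcodim.trans hpairs
      omega
    have e3 : L * (8 * (D - Module.finrank ℂ T)) ≤ 4 * d ^ 2 :=
      calc L * (8 * (D - Module.finrank ℂ T)) ≤ L * (4 * (d * (s - 1))) := Nat.mul_le_mul_left L e2
        _ = 4 * d * (L * (s - 1)) := by ring
        _ ≤ 4 * d * (d - 1) := Nat.mul_le_mul_left _ e1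
        _ ≤ 4 * d * d := Nat.mul_le_mul_left _ (Nat.sub_le d 1)
        _ = 4 * d ^ 2 := by ring
    have e4 : 8 * d ^ 2 ≤ D * L := by
      have h4L : Nat.sqrt D ≤ 4 * L := by omega
      have := Nat.mul_le_mul_left D h4L
      have h' : D * (4 * L) = 4 * (D * L) := by ring
      rw [h'] at this
      omega
    have e5 : L * (8 * (D - Module.finrank ℂ T)) ≤ L * D := by
      calc L * (8 * (D - Module.finrank ℂ T)) ≤ 4 * d ^ 2 := e3
        _ ≤ 8 * d ^ 2 := by omega
        _ ≤ D * L := e4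
        _ = L * D := by ring
    exact Nat.le_of_mul_le_mul_left e5 (by omega)
  -- ratio-speed from the one level function
  have hRS : RatioSpeed 1 Θ (U : Set (Matrix (Fin d) (Fin d) ℂ)) (T : Set (Matrix (Fin d) (Fin d) ℂ)) := by
    refine ratioSpeed_of_shifts 1 (fun i => (lvl i : ℤ)) Θ
      (fun i => ⟨by positivity, by exact_mod_cast hlvl_le i⟩) _ _ ?_ ?_
    · intro P hP i j hij
      have hlt : i < j := by
        by_contra hle
        push Not at hle
        exact hij (htri P hP i j hle)
      have := hlvl_anti i j hlt.le
      push_cast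
      omega
    · intro Q hQ i j hij
      obtain ⟨hQU, hQ0⟩ := hTmem Q hQ
      have hlt : i < j := by
        by_contra hle
        push Not at hle
        exact hij (htri Q hQU i j hle)
      have hle := hlvl_anti i j hlt.le
      have hne : lvl i ≠ lvl j := fun he => hij (hQ0 ⟨(i, j), hlt, he⟩)
      have hlt' : lvl j < lvl i := lt_of_le_of_ne hle (Ne.symm hne)
      push_cast
      omega
  exact ⟨T, hTU, hbudget, hRS⟩

/-- ★★ **THE TRIANGULARISABLE RUNG OF `DenseRatioLaw` (C = 32, ρ = 1).**  For every linear space `U ⊆ M_d(ℂ)` that is simultaneously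
strictly-upper triangularisable (`C A D ∈ 𝔫_d` for all `A ∈ U`, `C D = D C = 1`) and DENSE (`32·d² ≤ D·⌊√D⌋`, `D = dim U`): there is
`T ≤ U` with `4·(1+1)·(dim U − dim T) ≤ dim U` and `RatioSpeed 1 (⌊√D⌋/4) U T` — the conclusion of `DenseRatioLaw` verbatim, with
`ρ = 1`.  So the law's content sits entirely in the non-triangularisable regime. -/
theorem denseRatio_of_triangularisable (d : ℕ) (U : Submodule ℂ (Matrix (Fin d) (Fin d) ℂ))
    (C D : Matrix (Fin d) (Fin d) ℂ) (hCD : C * D = 1) (hDC : D * C = 1)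
    (htri : ∀ A ∈ U, ∀ i j : Fin d, j ≤ i → (C * A * D) i j = 0)
    (hdense : 32 * d ^ 2 ≤ Module.finrank ℂ U * Nat.sqrt (Module.finrank ℂ U)) :
    ∃ (ρ : ℕ) (T : Submodule ℂ (Matrix (Fin d) (Fin d) ℂ)), 1 ≤ ρ ∧ T ≤ U ∧
      4 * (ρ + 1) * (Module.finrank ℂ U - Module.finrank ℂ T) ≤ Module.finrank ℂ U ∧
      RatioSpeed ρ (Nat.sqrt (Module.finrank ℂ U) / 4)
        (U : Set (Matrix (Fin d) (Fin d) ℂ)) (T : Set (Matrix (Fin d) (Fin d) ℂ)) := by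
  classical
  -- conjugation as a linear equivalence
  let e : Matrix (Fin d) (Fin d) ℂ ≃ₗ[ℂ] Matrix (Fin d) (Fin d) ℂ :=
    { toFun := fun X => C * X * D
      invFun := fun X => D * X * C
      map_add' := fun X Y => by rw [Matrix.mul_add, Matrix.add_mul]
      map_smul' := fun c X => by rw [Matrix.mul_smul, Matrix.smul_mul, RingHom.id_apply]
      left_inv := fun X => by
        show D * (C * X * D) * C = X
        calc D * (C * X * D) * C = (D * C) * X * (D * C) := by simp only [Matrix.mul_assoc]
          _ = X := by rw [hDC, Matrix.one_mul, Matrix.mul_one]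
      right_inv := fun X => by
        show C * (D * X * C) * D = X
        calc C * (D * X * C) * D = (C * D) * X * (C * D) := by simp only [Matrix.mul_assoc]
          _ = X := by rw [hCD, Matrix.one_mul, Matrix.mul_one] }
  have he : ∀ X, e X = C * X * D := fun X => rfl
  set U' := U.map (e : Matrix (Fin d) (Fin d) ℂ →ₗ[ℂ] Matrix (Fin d) (Fin d) ℂ) with hU'
  have hfinU : Module.finrank ℂ U' = Module.finrank ℂ U := LinearEquiv.finrank_map_eq e U
  have htri' : ∀ A ∈ U', ∀ i j : Fin d, j ≤ i → A i j = 0 := by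
    intro A hA i j hij
    obtain ⟨B, hB, rfl⟩ := Submodule.mem_map.1 hA
    exact htri B hB i j hij
  have hdense' : 32 * d ^ 2 ≤ Module.finrank ℂ U' * Nat.sqrt (Module.finrank ℂ U') := by rwa [hfinU]
  obtain ⟨T', hT'U', hbudget', hRS'⟩ := denseRatio_of_strictUpper d U' htri' hdense'
  -- pull `T'` back
  set T := T'.map (e.symm : Matrix (Fin d) (Fin d) ℂ →ₗ[ℂ] Matrix (Fin d) (Fin d) ℂ) with hT
  have hfinT : Module.finrank ℂ T = Module.finrank ℂ T' := LinearEquiv.finrank_map_eq e.symm T'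
  have hback : U'.map (e.symm : Matrix (Fin d) (Fin d) ℂ →ₗ[ℂ] Matrix (Fin d) (Fin d) ℂ) = U := by
    rw [hU', ← Submodule.map_comp]
    have : (e.symm : Matrix (Fin d) (Fin d) ℂ →ₗ[ℂ] Matrix (Fin d) (Fin d) ℂ).comp
        (e : Matrix (Fin d) (Fin d) ℂ →ₗ[ℂ] Matrix (Fin d) (Fin d) ℂ) = LinearMap.id := by
      ext X; simp
    rw [this, Submodule.map_id]
  have hTU : T ≤ U := by rw [← hback]; exact Submodule.map_mono hT'U'
  refine ⟨1, T, le_rfl, hTU, ?_, ?_⟩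
  · rw [← hfinU, hfinT]
    have : 4 * (1 + 1) * (Module.finrank ℂ U' - Module.finrank ℂ T') = 8 * (Module.finrank ℂ U' - Module.finrank ℂ T') := by
      ring
    rw [this]; exact hbudget'
  · -- transport the ratio-speed along the conjugation
    rw [← hfinU]
    refine ratioSpeed_of_conj C D hCD hDC 1 _ _ _ ?_
    have hUimg : (fun X => C * X * D) '' (U : Set (Matrix (Fin d) (Fin d) ℂ)) = (U' : Set (Matrix (Fin d) (Fin d) ℂ)) := by
      rw [hU', Submodule.map_coe]; rfl
    have hTimg : (fun X => C * X * D) '' (T : Set (Matrix (Fin d) (Fin d) ℂ)) = (T' : Set (Matrix (Fin d) (Fin d) ℂ)) := by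
      rw [hT, Submodule.map_coe]
      ext Y
      constructor
      · rintro ⟨X, ⟨Z, hZ, rfl⟩, rfl⟩
        show C * (e.symm Z) * D ∈ (T' : Set (Matrix (Fin d) (Fin d) ℂ))
        have : C * (e.symm Z) * D = Z := e.apply_symm_apply Z
        rw [this]; exact hZ
      · intro hY
        exact ⟨e.symm Y, ⟨Y, hY, rfl⟩, e.apply_symm_apply Y⟩
    rw [hUimg, hTimg]
    exact hRS'

end Summit.ValiantsHypothesis.ValiantsHypothesis.Theorems.GrenetZeon.RatioSpeed

end
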